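import Mathlib

/-!
# LinDisjoint — the scalars `K ⊇ k` are linearly disjoint from the `k`-side of the tower (Layer C1 of the tower dictionary)

0-weight TOOL toward `TightDefectClasses.TowerDictionary` (decomp-res lens-5, g39; plan `NEXT-g40.md` §2 C1).  Pure commutative algebra
(imports `Mathlib` only).  Setting: fields `k ⊆ K`, an injective ring map `θ : K[x_σ] ↪ L` to a field, `χ = θ ∘ (k[x_σ] → K[x_σ])`, and a subring
`B ≤ L` all of whose elements are fractions `χ a / χ s` (`s ∉ ker χ`) — e.g. the images `B_i = ψ_i(𝒪_{X_i,x_i})` of the kernel-zero stalk chain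
(`StalkThread.lean`), which lie in the fraction closure of `χ(k[u][Z])`.

* `eq_zero_of_sum_C_mul_map_eq_zero` — COEFFICIENTWISE INDEPENDENCE: if `a : ι → K` is `k`-linearly independent and
  `∑ C(a_i) · Q_i^K = 0` in `K[x_σ]` for `Q_i ∈ k[x_σ]`, then every `Q_i = 0`.
* `linearIndependent_of_frac` — **every `k`-linearly independent family of `K` stays `B`-linearly independent in `L`**
  (clear denominators, apply the previous lemma, use injectivity of `θ`).  Consequences drawn in Layer C2/D1: `K·B ≅ K ⊗_k B` is a
  free `B`-module on a `k`-basis of `K` (flatness of `B → (K·B)_𝔴`), and `K·B / 𝔪_B = K ⊗_k κ(B)`.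

All PROVED, 0 sorry.  Sources: [Bourbaki, Algebra V §2 no. 5 (linear disjointness)], [ZariskiSamuel1958, Ch. III §15 Thm 35–36] — folklore.
-/

noncomputable section

set_option linter.dupNamespace false

namespace Summit.ResolutionOfSingularities.ResolutionOfSingularities.Theorems.LinDisjoint

open MvPolynomial

variable {k K : Type} [Field k] [Field K] [Algebra k K] {σ : Type}

/-- **Coefficientwise independence.**  If `a : ι → K` is `k`-linearly independent and `∑_{i ∈ s} C(a_i) · Q_i^K = 0` in `K[x_σ]`
(`Q_i ∈ k[x_σ]`, `Q^K` = coefficientwise base change), then `Q_i = 0` for all `i ∈ s`: compare the coefficients of each monomial.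
[folklore] -/
theorem eq_zero_of_sum_C_mul_map_eq_zero {ι : Type} {a : ι → K} (ha : LinearIndependent k a) (s : Finset ι)
    (Q : ι → MvPolynomial σ k) (h : ∑ i ∈ s, C (a i) * map (algebraMap k K) (Q i) = 0) :
    ∀ i ∈ s, Q i = 0 := by
  intro i hi
  ext m
  rw [coeff_zero]
  have hm : ∑ j ∈ s, (coeff m (Q j)) • a j = 0 := by
    have h1 := congrArg (coeff m) h
    rw [coeff_sum, coeff_zero] at h1
    rw [← h1]
    refine Finset.sum_congr rfl fun j _ => ?_
    rw [coeff_C_mul, coeff_map, Algebra.smul_def, mul_comm]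
  exact (linearIndependent_iff'.mp ha) s (fun j => coeff m (Q j)) hm i hi

/-- **Linear disjointness of the scalars from the `k`-side.**  Let `θ : K[x_σ] ↪ L` be injective, `χ = θ ∘ (k[x_σ] → K[x_σ])`, and
`B ≤ L` a subring of fractions `χ a / χ s` (`χ s ≠ 0`).  Then every `k`-linearly independent family `a : ι → K` is `B`-linearly
independent in `L` (as the family `θ(C(a_i))`): a relation `∑ b_i θ(C a_i) = 0`, `b_i = χ P_i / χ d_i`, clears to
`θ(∑ C(a_i) Q_i^K) = 0` with `Q_i = P_i ∏_{j ≠ i} d_j`, so `Q_i = 0` (`eq_zero_of_sum_C_mul_map_eq_zero`, `θ` injective) and `P_i = 0`.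
[cite: ZariskiSamuel1958, Ch. III §15] -/
theorem linearIndependent_of_frac {L : Type} [Field L] (θ : MvPolynomial σ K →+* L) (hθ : Function.Injective θ)
    (B : Subring L)
    (hB : ∀ x ∈ B, ∃ a s : MvPolynomial σ k, θ (map (algebraMap k K) s) ≠ 0 ∧
      x = θ (map (algebraMap k K) a) / θ (map (algebraMap k K) s))
    {ι : Type} {a : ι → K} (ha : LinearIndependent k a) :
    LinearIndependent B (fun i => θ (C (a i))) := by
  classical
  rw [linearIndependent_iff']
  intro s g hsum i hi
  set χ : MvPolynomial σ k →+* L := θ.comp (map (algebraMap k K)) with hχdef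
  have hχ : ∀ a, χ a = θ (map (algebraMap k K) a) := fun a => rfl
  -- numerators and denominators of the coefficients
  choose num den hden hfrac using fun j : ι => hB (g j) (g j).2
  have hden0 : ∀ j, den j ≠ 0 := fun j h0 => hden j (by rw [h0, map_zero, map_zero])
  -- common denominator `D = ∏ den`, cleared numerators `Q_j = num_j ∏_{l ≠ j} den_l`
  have hclear : ∀ j ∈ s, (g j : L) * χ (∏ l ∈ s, den l) = χ (num j * ∏ l ∈ s.erase j, den l) := by
    intro j hj
    rw [← Finset.prod_erase_mul s den hj, map_mul, map_mul, hfrac j, ← hχ, ← hχ]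
    have hne : χ (den j) ≠ 0 := hden j
    field_simp
  -- the cleared relation inside `K[x_σ]`
  have hrel : θ (∑ j ∈ s, C (a j) * map (algebraMap k K) (num j * ∏ l ∈ s.erase j, den l)) = 0 := by
    rw [map_sum]
    have h1 : ∀ j ∈ s, θ (C (a j) * map (algebraMap k K) (num j * ∏ l ∈ s.erase j, den l)) =
        ((g j : L) * θ (C (a j))) * χ (∏ l ∈ s, den l) := by
      intro j hj
      rw [map_mul, ← hχ, ← hclear j hj]
      ring
    rw [Finset.sum_congr rfl h1, ← Finset.sum_mul]
    have h2 : ∑ j ∈ s, (g j : L) * θ (C (a j)) = 0 := by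
      rw [← hsum]
      refine Finset.sum_congr rfl fun j _ => ?_
      rw [Subring.smul_def, smul_eq_mul]
    rw [h2, zero_mul]
  have hrel' : ∑ j ∈ s, C (a j) * map (algebraMap k K) (num j * ∏ l ∈ s.erase j, den l) = 0 :=
    hθ (by rw [hrel, map_zero])
  have hQ := eq_zero_of_sum_C_mul_map_eq_zero ha s _ hrel' i hi
  have hnum : num i = 0 :=
    (mul_eq_zero.mp hQ).resolve_right (Finset.prod_ne_zero_iff.mpr fun l _ => hden0 l)
  apply Subtype.ext
  change (g i : L) = 0
  rw [hfrac i, hnum, map_zero, map_zero, zero_div]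

end Summit.ResolutionOfSingularities.ResolutionOfSingularities.Theorems.LinDisjoint
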